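import Literature.AlgebraicGeometry.AbelianSchemes.PoincarePullbackStabilizer
import Literature.AlgebraicGeometry.AbelianSchemes.PoincarePullbackSliceSpread
import Literature.AlgebraicGeometry.AbelianSchemes.PoincarePullbackKernelCountOfQuotient
import Literature.AlgebraicGeometry.Morphisms.ConnectedComponentRationalPoint
import HarnessLib

/-!
# (K) for the dual-of-a-quotient over a complex base: `hStab` from a hat level structure and the count `n^{2g} ≤ #K·#K′`

Layer `Literature/AlgebraicGeometry/AbelianSchemes`, namespace `Literature.AlgebraicGeometry.AbelianSchemes.AbelianSchemeOver`.
THEOREMS ONLY (no definition, no named fact, no instance, no `sorry`).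

Setting of ★ `PoincarePullbackStabilizer` ([MumfordAV1970] §15 Thm. 1: the dual of `B := A/K` is `Â/K′`): an abelian scheme
`A/S` over a reduced locally Noetherian base, `K ≤ A(S)` finite `n`-torsion acting freely with quotient `B = A/K`,
`π := mulNDesc : B → A` (`ψ ≫ π = [n]_A`), the dual pair `D = (Â, 𝒫)` with the unit hypothesis `hD`, the rigidified family
`𝒩₁ := (π × 1_Â)^*𝒫` on `B ×_S Â`, and a finite subgroup `K′ ≤ Â(S)`.  The hypothesis `hStab` of the uniqueness theorem ★
`AbelianSchemeQuotientDualPairUnique.existsUnique_poincareQuotRigid_of_exists` (and of the (α2) wiring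
`universal_poincareQuotRigid_of_fpqcLocal`) — «for all `f : T → S` and `a a′ : T → Â` over `f`,
`(1_B × a)^*𝒩₁ ≅ (1_B × a′)^*𝒩₁ ⟹ a ≫ ψ̂ = a′ ≫ ψ̂`» — is reduced by ★ `hStab_of_spread_of_ncard_le` (road (R-ℂ)) to a point
COUNT at the points with values in one algebraically closed field plus a spreading hypothesis.  This file discharges the
road over a base `S` LOCALLY OF FINITE TYPE OVER `ℂ`:

* §1 `natCard_le_ncard_setOf_section_mem` — if `K′` consists of constant sections `φ̂(c)` of a level-`n` structure `φ̂` on `Â`,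
  then `#K′ ≤ #{c | φ̂(c) ∈ K′}`;
* §2 **`hStab_of_level_of_count`** — `hStab` from `K′ ⊆ Stab(𝒩₁)` (the input of ★ `poincareStabilizerStructure`), a level-`n`
  structure `φ̂` on `Â` with `K′ ⊆ φ̂((ℤ/n)^{2g})`, and the COUNT at complex points
  «`#{b ∈ Â_t(ℂ) : (1_B × b)^*𝒩₁ ≅ 𝒪} · #K ≤ n^{2g}`» (the injectivity half of [MumfordAV1970] §15 Thm. 1 at a complex point,
  B-p02 (g11)'s `PoincarePullbackKernelCountComplex`) together with `n^{2g} ≤ #K · #K′`; the spreading hypothesis is ★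
  `PoincarePullbackSliceSpread.exists_point_slice_iso_unit_of_nonempty` with its `hpt` binder («every connected component of `S`
  has a complex point») discharged by ★ `Morphisms.exists_base_closedPoint_mem_connectedComponent` (B-p12 (g14)).
* §3 (ed. 2) **`hStab_of_level_of_natCard_eq`** — THE ONE-TOKEN FORM for the D6 package composer: the count at complex points
  is DISCHARGED by ★ `finite_and_ncard_mul_natCard_le_pow` (B-p02 (g11), `PoincarePullbackKernelCountOfQuotient`:
  `#T_t · #K ≤ n^{2g}` for `A` of relative dimension `g`), leaving the binders `(p) (hA : A.IsOfRelDim g) (hn0) (hD) (φ̂) (hK'φ)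
  (hK'stab) (hcard : #K · #K′ = n^{2g})` — the last two literally the inputs of ★ `poincareStabilizerStructure` and of ★
  `exists_fpqcCover_pullback_poincareQuotRigid_iso_of_isLocallyNoetherian`.

Cell `hodgecm-mathlib` (D-0151), HECKE-LINK socket (B) / D6 `h4` package, brick (K) «the scheme-theoretic stabiliser of `𝒩₁` is
the constant group `K′`» (B-plan1 (g15) 00:18:01Z; B-p09 (g10) ★ p747184 / p748159 / p751058; B-p02 (g11) ★ p750413 / (K5c);
B-p12 (g14) ★ p751840).  Count-neutral; HC_CM is proved only modulo the 7 printed citations until rung 0 closes.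

## References
* [MumfordAV1970] D. Mumford, *Abelian Varieties* (1970), §15 Thm. 1 (p. 143).
* [MilneAV2008] J. S. Milne, *Abelian Varieties* (v2.00, 2008), I §8 (pp. 36–37).
* [MumfordFogartyKirwan1994] D. Mumford, J. Fogarty, F. Kirwan, *Geometric Invariant Theory*, 3rd ed. (1994), Ch. 7 §2
  Definition 7.1 (p. 129).
* [StacksProject] Tag 04MF.
-/

set_option autoImplicit false

noncomputable section

-- `poincarePullbackBundle.L = (π ▷ Â)^*𝒫`, `(A.baseChange f).X = (Over.pullback f).obj A.X` hold by `rfl` only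
-- (`Scheme.Modules` / `SheafOfModules` are not reducible, as in Mathlib's `AlgebraicGeometry/Modules/Sheaf.lean`).
set_option backward.isDefEq.respectTransparency false

open CategoryTheory CategoryTheory.Limits AlgebraicGeometry MonoidalCategory CartesianMonoidalCategory
open scoped MonObj

namespace Literature.AlgebraicGeometry.AbelianSchemes

namespace AbelianSchemeOver

open Literature.AlgebraicGeometry.RelativeSpec Literature.AlgebraicGeometry.Motives Literature.AlgebraicGeometry.Morphisms

/-! ## §1 Counting the constant sections in `K′` -/

variable {S : Scheme.{0}} (A : AbelianSchemeOver S)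

/-- **If `K′ ≤ Â(S)` consists of constant sections `φ̂(c)` of a level-`n` structure `φ̂` (`n ≠ 0`), then
`#K′ ≤ #{c : (ℤ/n)^{2g} | φ̂(c) ∈ K′}`** — `c ↦ φ̂(c)` maps that (finite) index set ONTO `K′`.
[cite: MumfordFogartyKirwan1994, Ch. 7 §2 Definition 7.1 (p. 129)] -/
theorem natCard_le_ncard_setOf_section_mem {g n : ℕ} [NeZero n] (φ : LevelStructure g n A)
    (K' : Subgroup A.Sections) (hK'φ : (K' : Set A.Sections) ⊆ Set.range φ.section_) :
    Nat.card K' ≤ {c : Fin g ⊕ Fin g → ZMod n | φ.section_ c ∈ K'}.ncard := by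
  classical
  rw [← Nat.card_coe_set_eq]
  refine Nat.card_le_card_of_surjective
    (fun c : {c : Fin g ⊕ Fin g → ZMod n | φ.section_ c ∈ K'} => (⟨φ.section_ c.1, c.2⟩ : K')) ?_
  rintro ⟨k, hk⟩
  obtain ⟨c, hc⟩ := hK'φ hk
  exact ⟨⟨c, by simpa only [Set.mem_setOf_eq, hc] using hk⟩, Subtype.ext hc⟩

/-! ## §2 `hStab` over a complex base from a hat level structure and the count -/

variable {Y : Scheme.{0}} (u : S ⟶ Y) (K : Subgroup A.Sections) [IsCommMonObj A.X] {n : ℕ}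
  (hK : ∀ σ : K, (σ : A.Sections) ^ n = 1)
  [Finite K] [Y.IsSeparated] [IsSeparated (A.X.hom ≫ u)] [S.IsSeparated]
  (hcov : ∀ x : A.left, ∃ O : (A.translationActionOver u K).StableAffineOpens, x ∈ O.1)
  [LocallyOfFiniteType (A.X.hom ≫ u)] [IsLocallyNoetherian Y]
  (hG : ∃ _ : GrpObj (A.quotientOver u K), IsMonHom (A.quotientMk u K hcov))
  (hsm : Smooth (A.quotientOver u K).hom) (hgc : GeometricallyConnected (A.quotientOver u K).hom)
  (D : A.DualPair) [IsAffine Y]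
  (hfree : ∀ (Ω : Type) [Field Ω] [IsAlgClosed Ω] (x : Spec (.of Ω) ⟶ A.left) (σ : K), σ ≠ 1 →
    x ≫ (A.translation (σ : A.Sections)).left ≠ x)
  (K' : Subgroup D.hat.Sections) [Finite K'] [IsSeparated (D.hat.X.hom ≫ u)]
  (hcov' : ∀ x : D.hat.left, ∃ O : (D.hat.translationActionOver u K').StableAffineOpens, x ∈ O.1)

/-- **`hStab` over a base locally of finite type over `ℂ`, from `K′ ⊆ Stab(𝒩₁)`, a hat level structure covering `K′`, and the
count at complex points.**  For `S` reduced, locally Noetherian and locally of finite type over `ℂ`, `n ≠ 0`, the unit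
hypothesis `hD`, a level-`n` structure `φ̂` on `Â` with `K′ ⊆ φ̂((ℤ/n)^{2g})`, `K′ ⊆ Stab(𝒩₁)`,
`#{b ∈ Â_t(ℂ) : (1_B × b)^*𝒩₁ ≅ 𝒪} · #K ≤ n^{2g}` at every complex point `t` of `S`, and `n^{2g} ≤ #K · #K′`: for all
`f : T → S` and `a a′ : T → Â` over `f`, `(1_B × a)^*𝒩₁ ≅ (1_B × a′)^*𝒩₁ ⟹ a ≫ ψ̂ = a′ ≫ ψ̂`, `ψ̂ : Â → Â/K′`.  Proof: ★
`hStab_of_spread_of_ncard_le` at `Ω₀ := ℂ`; `hK′triv` by ★ (K-dict) `nonempty_pullback_whiskerLeft_translation_iso_iff` + ★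
`nonempty_pullback_baseChangeToProd_restrict_iso_unit`; `hspread` by ★ `exists_point_slice_iso_unit_of_nonempty` with ★
`exists_base_closedPoint_mem_connectedComponent`; `hn` as `S` is a `ℚ`-scheme; the set count from the two numeric counts and §1
after cancelling `#K ≥ 1`. [cite: MumfordAV1970, §15 Thm. 1 (p. 143)] [cite: MilneAV2008, I §8 (pp. 36–37)] -/
theorem hStab_of_level_of_count [IsReduced S] [IsLocallyNoetherian S] (p : S ⟶ Spec (.of ℂ)) [LocallyOfFiniteType p]
    (hn0 : n ≠ 0) (hD : Nonempty ((Scheme.Modules.pullback (DualPair.unitHatSlice D)).obj D.P ≅ SheafOfModules.unit _))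
    {g : ℕ} (φ : LevelStructure g n D.hat) (hK'φ : (K' : Set D.hat.Sections) ⊆ Set.range φ.section_)
    (hK'stab : K' ≤ A.poincareStabilizerSubgroup u K hK hcov hG hsm hgc D hfree)
    (hcount : ∀ t : Spec (.of ℂ) ⟶ S,
      {b : D.hat.FibrePoints t | Nonempty ((Scheme.Modules.pullback
          ((A.quotientBy u K hcov hG hsm hgc).baseChangeToProd D.hat t b.left (Over.w b))).obj
          (A.poincarePullbackBundle u K hK hcov hG hsm hgc D hfree).L ≅ SheafOfModules.unit _)}.Finite ∧
      {b : D.hat.FibrePoints t | Nonempty ((Scheme.Modules.pullback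
          ((A.quotientBy u K hcov hG hsm hgc).baseChangeToProd D.hat t b.left (Over.w b))).obj
          (A.poincarePullbackBundle u K hK hcov hG hsm hgc D hfree).L ≅ SheafOfModules.unit _)}.ncard * Nat.card K ≤
        n ^ (2 * g))
    (hcard : n ^ (2 * g) ≤ Nat.card K * Nat.card K')
    {T : Scheme.{0}} (f : T ⟶ S) (a a' : T ⟶ D.hat.X.left) (ha : a ≫ D.hat.X.hom = f)
    (ha' : a' ≫ D.hat.X.hom = f)
    (h : Nonempty ((Scheme.Modules.pullback ((A.quotientBy u K hcov hG hsm hgc).baseChangeToProd D.hat f a ha)).obj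
        (A.poincarePullbackBundle u K hK hcov hG hsm hgc D hfree).L ≅
      (Scheme.Modules.pullback ((A.quotientBy u K hcov hG hsm hgc).baseChangeToProd D.hat f a' ha')).obj
        (A.poincarePullbackBundle u K hK hcov hG hsm hgc D hfree).L)) :
    a ≫ (D.hat.quotientMk u K' hcov').left = a' ≫ (D.hat.quotientMk u K' hcov').left := by
  classical
  haveI : NeZero n := ⟨hn0⟩
  -- `n` is invertible on the `ℚ`-scheme `S`
  have hn : ∀ s : S, (n : S.residueField s) ≠ 0 := fun s => by
    let c : ℂ →+* S.residueField s :=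
      (S.evaluation ⊤ s trivial).hom.comp (p.appTop.hom.comp (Scheme.ΓSpecIso (.of ℂ)).inv.hom)
    haveI : CharZero (S.residueField s) := (RingHom.charZero_iff c.injective).mp inferInstance
    exact_mod_cast hn0
  -- `#K ≥ 1`
  have hKpos : 0 < Nat.card K := Nat.card_pos
  refine A.hStab_of_spread_of_ncard_le u K hK hcov hG hsm hgc D hfree K' hcov' φ hn ℂ hD ?_ ?_ ?_ f a a' ha ha' h
  · -- `hK′triv`: every `k ∈ K′ ⊆ Stab(𝒩₁)` has trivial class at every complex point
    intro k hk t
    exact DualPair.nonempty_pullback_baseChangeToProd_restrict_iso_unit (X := A.quotientBy u K hcov hG hsm hgc) D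
      (A.mulNDesc u K hK hcov) k
      ((DualPair.nonempty_pullback_whiskerLeft_translation_iso_iff D (A.mulNDesc u K hK hcov) k hD).1 (hK'stab hk)) t
  · -- `hcard`: the set count at complex points
    intro t
    refine ⟨(hcount t).1, ?_⟩
    have h1 := (hcount t).2
    have h2 : Nat.card K * Nat.card K' ≤
        Nat.card K * {c : Fin g ⊕ Fin g → ZMod n | φ.section_ c ∈ K'}.ncard :=
      Nat.mul_le_mul_left _ (D.hat.natCard_le_ncard_setOf_section_mem φ K' hK'φ)
    have h3 := (h1.trans hcard).trans h2
    rw [Nat.mul_comm] at h3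
    exact Nat.le_of_mul_le_mul_left h3 hKpos
  · -- `hspread`: ★ (K4-spread) with every component meeting a complex point (★ B-p12 (g14))
    intro c U w _ hU
    exact DualPair.exists_point_slice_iso_unit_of_nonempty A u K hK hcov hG hsm hgc D hfree ℂ hD hn φ
      (exists_base_closedPoint_mem_connectedComponent p) c w hU

/-! ## §3 The one-token form: the count at complex points discharged (ed. 2) -/

/-- **THE D6 `hStab` BINDER OVER A COMPLEX BASE — one token for the package composer.**  For `S` reduced, locally Noetherian
and locally of finite type over `ℂ`, `A/S` of relative dimension `g`, `n ≠ 0`, the unit hypothesis `hD`, a level-`n`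
structure `φ̂` on `Â` with `K′ ⊆ φ̂((ℤ/n)^{2g})`, `K′ ⊆ Stab(𝒩₁)` and `#K · #K′ = n^{2g}`: for all `f : T → S` and
`a a′ : T → Â` over `f`, `(1_B × a)^*𝒩₁ ≅ (1_B × a′)^*𝒩₁ ⟹ a ≫ ψ̂ = a′ ≫ ψ̂` — ★ `hStab_of_level_of_count` with its `hcount`
binder DISCHARGED by ★ `finite_and_ncard_mul_natCard_le_pow` ([MumfordAV1970] §15 Thm. 1 at a complex point: `#T_t · #K ≤ n^{2g}`).
This is the `hStab` hypothesis of ★ `existsUnique_poincareQuotRigid_of_exists` / ★ `universal_poincareQuotRigid_of_fpqcLocal` /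
★ `exists_fpqcCover_pullback_poincareQuotRigid_iso_of_isLocallyNoetherian` verbatim, with `φ̂` and `hcard` shared with the last.
[cite: MumfordAV1970, §15 Thm. 1 (p. 143)] [cite: MilneAV2008, I §8 (pp. 36–37)] -/
theorem hStab_of_level_of_natCard_eq [IsReduced S] [IsLocallyNoetherian S] (p : S ⟶ Spec (.of ℂ)) [LocallyOfFiniteType p]
    {g : ℕ} (hA : A.IsOfRelDim g) (hn0 : n ≠ 0)
    (hD : Nonempty ((Scheme.Modules.pullback (DualPair.unitHatSlice D)).obj D.P ≅ SheafOfModules.unit _))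
    (φ : LevelStructure g n D.hat) (hK'φ : (K' : Set D.hat.Sections) ⊆ Set.range φ.section_)
    (hK'stab : K' ≤ A.poincareStabilizerSubgroup u K hK hcov hG hsm hgc D hfree)
    (hcard : Nat.card K * Nat.card K' = n ^ (2 * g))
    {T : Scheme.{0}} (f : T ⟶ S) (a a' : T ⟶ D.hat.X.left) (ha : a ≫ D.hat.X.hom = f)
    (ha' : a' ≫ D.hat.X.hom = f)
    (h : Nonempty ((Scheme.Modules.pullback ((A.quotientBy u K hcov hG hsm hgc).baseChangeToProd D.hat f a ha)).obj
        (A.poincarePullbackBundle u K hK hcov hG hsm hgc D hfree).L ≅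
      (Scheme.Modules.pullback ((A.quotientBy u K hcov hG hsm hgc).baseChangeToProd D.hat f a' ha')).obj
        (A.poincarePullbackBundle u K hK hcov hG hsm hgc D hfree).L)) :
    a ≫ (D.hat.quotientMk u K' hcov').left = a' ≫ (D.hat.quotientMk u K' hcov').left :=
  A.hStab_of_level_of_count u K hK hcov hG hsm hgc D hfree K' hcov' p hn0 hD φ hK'φ hK'stab
    (fun t => A.finite_and_ncard_mul_natCard_le_pow u K hK hcov hG hsm hgc D hfree hA hn0 t) hcard.ge f a a' ha ha' h

end AbelianSchemeOver

end Literature.AlgebraicGeometry.AbelianSchemes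

end
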